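import Mathlib
import Summits.ValiantsHypothesis.ValiantsHypothesis.Theorems.BarrierLeverPartitionMinorsHitByVPSimplexJoinTwoDeepRank

/-!
# Route BarrierLever — item `PartitionMinorsHitByVP` (stmt-ValiantsHypothesis-19717):
# UNIFORM PIECES ARE AFFINELY SPANNING — the level-0 (affine) obstruction for a piece with ANY number of slots

Helper file (`--supports stmt-ValiantsHypothesis-19717`; cell valiant-natproofs, rung V4, 𝒟-side door (c), line `hidden_states`,
uniform-menu lane; prover seat val-np-p3 gen 12). Definition-free. Closes NO item. The `k`-slot, level-`0` companion of the two-slot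
lemmas `…TwoDeep` / `…TwoDeepRank` / `…TwoSlotsLevels` (case (B3) of the case map, memo val-np-p3 g12 §2(f)).

MECHANISM. The columns of a piece `p` of an exact-support design are the points `z_k = T p none + Σ_f t_{f, g_k f}`; on the rows of size
`≤ 1` (the row `∅` and the singletons) the column `k` is the vector `(1, z_k)`, which is the image of the indicator data
`(1, [g_k f = some j]_{f,j})` under a fixed linear map. Hence every `λ` on the columns of `p` with `Σ_k λ_k = 0` and
`Σ_{k : g_k f = j} λ_k = 0` for all live `(f, j)` is a column relation on all rows of size `≤ 1`; these `λ` form a space of dimension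
`≥ n_p − 1 − Σ_f |S p f|` (`n_p` = number of columns of `p`; rank–nullity), independent as vectors of `ℂ^r`. If the row family has MORE
THAN `r − (n_p − 1 − Σ_f |S p f|)` members of size `≤ 1`, the remaining rows cannot separate them: the `u`-side matrix is SINGULAR for
every table (**`det_eq_zero_of_affine_deficit`**). For a single piece (`r = n_p`): more than `1 + Σ_f |S p f|` rows of size `≤ 1`
suffice — so a UNIFORM piece with at least `h + 2` columns has total width `Σ_f |S p f| ≥ h` («uniform pieces are affinely spanning»;
e.g. `V_{h/3}³`, of size `≈ h³/27 > (2h)²`, is never uniform). Nothing here bears on crux 14610 or VP ≠ VNP; item 19717 stays OPEN.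
-/

set_option linter.dupNamespace false

namespace Summit.ValiantsHypothesis.ValiantsHypothesis.Theorems.BarrierLever.SimplexJoin

open Finset Matrix

/-- **THE AFFINE DEFICIT.** Let `p` be a piece of an exact-support design `e`, and `c` an injective enumeration of `n` of its columns
(typically all of them). If the row family `u` has more than `r − (n − 1 − Σ_f |S p f|)` members of size `≤ 1` (and
`n > 1 + Σ_f |S p f|`), then for EVERY table the `u`-side matrix of the design is singular. -/
theorem det_eq_zero_of_affine_deficit (h M D N r : ℕ) (u : Fin r → Finset (Fin h))
    (S : Fin M → Fin D → Finset (Fin N))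
    (e : Fin r → Fin M × (Fin D → Option (Fin N)))
    (hlive : ∀ c : Fin M × (Fin D → Option (Fin N)),
      c ∈ Set.range e ↔ ∀ (f : Fin D) (j : Fin N), c.2 f = some j → j ∈ S c.1 f)
    (p : Fin M) (n : ℕ) (c : Fin n → Fin r) (hc : Function.Injective c) (hcp : ∀ x, (e (c x)).1 = p)
    (hrows : r + (1 + ∑ f : Fin D, (S p f).card) <
      (Finset.univ.filter fun i => (u i).card ≤ 1).card + n)
    (T : Fin M → Option (Fin D × Fin N) → Fin h → ℂ) :
    (Matrix.of fun i k : Fin r => ∏ a ∈ u i,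
      (T (e k).1 none a + ∑ f : Fin D, ((e k).2 f).elim 0 fun j => T (e k).1 (some (f, j)) a)).det = 0 := by
  classical
  -- live (slot, option) pairs of the piece
  let LiveF : Finset (Σ _ : Fin D, Fin N) := Finset.univ.sigma fun f => S p f
  have hLive : LiveF.card = ∑ f : Fin D, (S p f).card := Finset.card_sigma _ _
  -- the indicator map: λ ↦ (Σ λ, (Σ_{x : g_x f = some j} λ_x)_{(f,j) live})
  let Φ : (Fin n → ℂ) →ₗ[ℂ] (ℂ × (LiveF → ℂ)) :=
    { toFun := fun lam => (∑ x, lam x, fun fj => ∑ x, if (e (c x)).2 fj.1.1 = some fj.1.2 then lam x else 0)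
      map_add' := by
        intro a b
        refine Prod.ext ?_ (funext fun fj => ?_)
        · simp [Finset.sum_add_distrib]
        · simp only [Prod.snd_add, Pi.add_apply]
          rw [← Finset.sum_add_distrib]
          exact Finset.sum_congr rfl fun x _ => by split_ifs <;> simp
      map_smul' := by
        intro a lam
        refine Prod.ext ?_ (funext fun fj => ?_)
        · simp [Finset.mul_sum]
        · simp only [Prod.smul_snd, Pi.smul_apply, smul_eq_mul, RingHom.id_apply]
          rw [Finset.mul_sum]
          exact Finset.sum_congr rfl fun x _ => by split_ifs <;> simp }
  set d := n - (1 + ∑ f : Fin D, (S p f).card) with hd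
  have hker : d ≤ Module.finrank ℂ (LinearMap.ker Φ) := by
    have h1 := LinearMap.finrank_range_add_finrank_ker Φ
    have h2 : Module.finrank ℂ (LinearMap.range Φ) ≤ Module.finrank ℂ (ℂ × (LiveF → ℂ)) := Submodule.finrank_le _
    rw [Module.finrank_prod, Module.finrank_self, Module.finrank_fintype_fun_eq_card, Fintype.card_coe, hLive] at h2
    rw [Module.finrank_fintype_fun_eq_card, Fintype.card_fin] at h1
    omega
  let b := Module.finBasis ℂ (LinearMap.ker Φ)
  let g : Fin d → (Fin n → ℂ) := fun s => ((b (Fin.castLE hker s) : LinearMap.ker Φ) : Fin n → ℂ)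
  have hg_li : LinearIndependent ℂ g := by
    have h1 : LinearIndependent ℂ (fun s : Fin d => b (Fin.castLE hker s)) :=
      b.linearIndependent.comp _ (Fin.castLE_injective hker)
    exact h1.map' (LinearMap.ker Φ).subtype (Submodule.ker_subtype _)
  have hg_mem : ∀ s, Φ (g s) = 0 := fun s => LinearMap.mem_ker.mp (b (Fin.castLE hker s)).2
  have hg_sum : ∀ s, ∑ x, g s x = 0 := fun s => by
    have := congrArg Prod.fst (hg_mem s)
    simpa [Φ] using this
  have hg_slot : ∀ s (f : Fin D) (j : Fin N), j ∈ S p f →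
      ∑ x, (if (e (c x)).2 f = some j then g s x else 0) = 0 := by
    intro s f j hj
    have hmem : (⟨f, j⟩ : Σ _ : Fin D, Fin N) ∈ LiveF := Finset.mem_sigma.mpr ⟨Finset.mem_univ _, hj⟩
    have := congrFun (congrArg Prod.snd (hg_mem s)) ⟨⟨f, j⟩, hmem⟩
    simpa [Φ] using this
  -- the kernel vectors in `ℂ^r`: `g s` pushed forward along `c`
  let v : Fin d → Fin r → ℂ := fun s k => if hk : ∃ x, c x = k then g s hk.choose else 0
  have hvc : ∀ s x, v s (c x) = g s x := by
    intro s x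
    have hx : ∃ x', c x' = c x := ⟨x, rfl⟩
    simp only [v, dif_pos hx]
    exact congrArg (g s) (hc hx.choose_spec)
  have hv0 : ∀ s k, (¬ ∃ x, c x = k) → v s k = 0 := fun s k hk => by simp only [v, dif_neg hk]
  set Mx : Matrix (Fin r) (Fin r) ℂ := Matrix.of fun i k : Fin r => ∏ a ∈ u i,
      (T (e k).1 none a + ∑ f : Fin D, ((e k).2 f).elim 0 fun j => T (e k).1 (some (f, j)) a) with hMx
  -- (i) rows of size ≤ 1 kill every `v s`
  have hpoint : ∀ x a, T (e (c x)).1 none a + ∑ f : Fin D, ((e (c x)).2 f).elim 0 (fun j => T (e (c x)).1 (some (f, j)) a) =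
      T p none a + ∑ f : Fin D, ∑ j ∈ S p f, (if (e (c x)).2 f = some j then T p (some (f, j)) a else 0) := by
    intro x a
    rw [hcp x]
    congr 1
    refine Finset.sum_congr rfl fun f _ => ?_
    rcases hfx : (e (c x)).2 f with _ | j
    · simp
    · have hj : j ∈ S p f := by
        have := ((hlive (e (c x))).mp ⟨c x, rfl⟩) f j hfx
        rwa [hcp x] at this
      rw [Finset.sum_eq_single j]
      · simp
      · intro j' _ hj'; simp [Ne.symm hj']
      · intro hj'; exact absurd hj hj'
  have hsmall : ∀ i, (u i).card ≤ 1 → ∀ s, ∑ k, Mx i k * v s k = 0 := by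
    intro i hi s
    -- restrict the sum to the columns of `p`
    have hsum : ∑ k, Mx i k * v s k = ∑ x, Mx i (c x) * g s x := by
      rw [← Finset.sum_subset (Finset.subset_univ (Finset.univ.image c))]
      · rw [Finset.sum_image fun x _ x' _ hxx' => hc hxx']
        exact Finset.sum_congr rfl fun x _ => by rw [hvc]
      · intro k _ hk
        have : ¬ ∃ x, c x = k := by
          rintro ⟨x, rfl⟩; exact hk (Finset.mem_image.mpr ⟨x, Finset.mem_univ _, rfl⟩)
        rw [hv0 s k this, mul_zero]
    rw [hsum]
    rcases Nat.le_one_iff_eq_zero_or_eq_one.mp hi with h0 | h1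
    · -- row ∅: Σ g = 0
      have hu : u i = ∅ := Finset.card_eq_zero.mp h0
      simp only [hMx, Matrix.of_apply, hu, Finset.prod_empty, one_mul]
      exact hg_sum s
    · obtain ⟨a, ha⟩ := Finset.card_eq_one.mp h1
      simp only [hMx, Matrix.of_apply, ha, Finset.prod_singleton, hpoint]
      rw [show ∑ x, (T p none a + ∑ f : Fin D, ∑ j ∈ S p f,
            (if (e (c x)).2 f = some j then T p (some (f, j)) a else 0)) * g s x =
          T p none a * ∑ x, g s x + ∑ f : Fin D, ∑ j ∈ S p f,
            T p (some (f, j)) a * ∑ x, (if (e (c x)).2 f = some j then g s x else 0) by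
        simp only [add_mul, Finset.sum_add_distrib, Finset.mul_sum, Finset.sum_mul]
        congr 1
        rw [Finset.sum_comm]
        refine Finset.sum_congr rfl fun f _ => ?_
        rw [Finset.sum_comm]
        refine Finset.sum_congr rfl fun j _ => Finset.sum_congr rfl fun x _ => ?_
        split_ifs <;> ring]
      rw [hg_sum s, mul_zero, zero_add]
      exact Finset.sum_eq_zero fun f _ => Finset.sum_eq_zero fun j hj => by rw [hg_slot s f j hj, mul_zero]
  -- (ii) independence of the `v s`
  have hvI : ∀ cc : Fin d → ℂ, (∑ s, cc s • v s = 0) → cc = 0 := by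
    intro cc hcc
    have := (Fintype.linearIndependent_iff.mp hg_li) cc ?_
    · funext s; exact this s
    · funext x
      have := congrFun hcc (c x)
      simpa [hvc] using this
  -- (iii) the large rows are too few
  let Big := {i : Fin r // ¬ (u i).card ≤ 1}
  have hBig : Fintype.card Big < d := by
    rw [Fintype.card_subtype_compl, Fintype.card_fin, Fintype.card_subtype]
    have : (Finset.univ.filter fun i => (u i).card ≤ 1).card ≤ r := (Finset.card_filter_le _ _).trans (by simp)
    omega
  let Ψ : (Fin d → ℂ) →ₗ[ℂ] (Big → ℂ) :=
    { toFun := fun cc i => ∑ s, cc s * ∑ k, Mx i.1 k * v s k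
      map_add' := by
        intro a a'; funext i; simp only [Pi.add_apply]; rw [← Finset.sum_add_distrib]
        exact Finset.sum_congr rfl fun s _ => by ring
      map_smul' := by
        intro a cc; funext i; simp only [Pi.smul_apply, smul_eq_mul, RingHom.id_apply]; rw [Finset.mul_sum]
        exact Finset.sum_congr rfl fun s _ => by ring }
  have hΨ : LinearMap.ker Ψ ≠ ⊥ := by
    apply LinearMap.ker_ne_bot_of_finrank_lt
    rw [Module.finrank_fintype_fun_eq_card, Module.finrank_fintype_fun_eq_card, Fintype.card_fin]
    exact hBig
  obtain ⟨cc, hcker, hc0⟩ := (Submodule.ne_bot_iff _).mp hΨ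
  let w : Fin r → ℂ := fun k => ∑ s, cc s * v s k
  have hw : w ≠ 0 := by
    intro hw
    apply hc0
    apply hvI cc
    funext k
    simp only [Finset.sum_apply, Pi.smul_apply, smul_eq_mul, Pi.zero_apply]
    exact congrFun hw k
  apply (Matrix.exists_mulVec_eq_zero_iff).mp
  refine ⟨w, hw, funext fun i => ?_⟩
  simp only [Matrix.mulVec, dotProduct, Pi.zero_apply]
  have hrew : ∑ k, Mx i k * w k = ∑ s, cc s * ∑ k, Mx i k * v s k := by
    simp only [w, Finset.mul_sum]
    rw [Finset.sum_comm]
    exact Finset.sum_congr rfl fun s _ => Finset.sum_congr rfl fun k _ => by ring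
  rw [hrew]
  by_cases hi : (u i).card ≤ 1
  · exact Finset.sum_eq_zero fun s _ => by rw [hsmall i hi s, mul_zero]
  · have := congrFun (LinearMap.mem_ker.mp hcker) ⟨i, hi⟩
    simpa [Ψ] using this

end Summit.ValiantsHypothesis.ValiantsHypothesis.Theorems.BarrierLever.SimplexJoin
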